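import Summits.SmoothPoincare4.SmoothPoincare4.Theorems.CylinderEntropyCylinderRungTwoKillingFluxDefs
import Summits.SmoothPoincare4.SmoothPoincare4.Theorems.CylinderEntropyCylinderRungTwoAreaDissipationMetric
import Literature.Geometry.Lorentzian.VolumeDensityRatio
import Literature.Geometry.Riemannian.EmbeddedSubmanifoldHausdorff
import HarnessLib

/-!
# Area dissipation along a smooth cylinder flow (stub `stub_areaDissipation`, line `killing-flux`)

Part 2 (final) of the proof of the registered stub `stub_areaDissipation` of line `killing-flux` of
the crux `CylinderEntropy.CylinderRungTwo` (stmt-SmoothPoincare4-7631), input (a) of the immortal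
half ("large-scale relaxation"): along a smooth mean curvature flow `IsCylinderMCF M F ν T`
(`CylinderEntropyCylinderRungTwoKillingFluxDefs.lean`) of closed embedded cross-sections of
`N = S⁴ × ℝ ⊂ ℝ⁶`, the area `t ↦ μH⁴(F_t(M))` is non-increasing on `[T, ∞)` — classically
`d/dt Area(M_t) = -∫_{M_t} H² dμ_t ≤ 0` (Huisken 1984, §3; Mantegazza 2011, Prop. 2.3.3).

* `IsCylinderMCF.hasDerivAt_sqrt_det_gram`, `IsCylinderMCF.hasDerivAt_sqrt_det_gram_localFrame` —
  **the area element decays by `H²`**: `d/dt √det ((F_t^*δ)(βᵢ, βⱼ)) = -H² √det (…)` for every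
  basis `β` of `T_p M`, in particular for the coordinate frame at `w` (part 1,
  `hasDerivAt_sqrt_det_gram_of_normalVelocity` with `φ = H`; `H`, computed in `ℝ⁶` for the unit
  normal `ν ⊥ n_N`, IS the mean curvature of `Σ_t ⊂ N`). This is the pointwise identity that
  Hamilton's monotonicity formula in `N` integrates;
* `IsCylinderMCF.antitoneOn_sqrt_det_gram_localFrame` — hence `t ↦ √D_t(w)` is non-increasing;
* `IsCylinderMCF.euclideanHausdorffMeasure_range_eq` — area formula `μHE⁴(F_t(M)) = μ_{F_t^*δ}(M)`
  (tree `riemannianMeasure_induced_apply`, any codimension; `F t` is injective, being an embedding);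
* `IsCylinderMCF.riemannianMeasure_univ_eq_lintegral` — `μ_t(M) = ∫ √D_t/√D_s dμ_s`
  (tree `riemannianMeasure_eq_withDensity_sqrt_det_div`, the chart densities at the chart centres
  being the coordinate-frame Gram determinants, `chartGramMatrix_inducedRiemannianMetric_self_of_immersion`);
* `IsCylinderMCF.antitoneOn_euclideanHausdorffMeasure_range`,
  `IsCylinderMCF.antitoneOn_hausdorffMeasure_range` — monotonicity of the integrand gives
  `μHE⁴(F_t(M)) ≤ μHE⁴(F_s(M))` for `T ≤ s ≤ t`, and `μHE⁴ = c • μH⁴` with `c ≠ 0`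
  (`Measure.euclideanHausdorffMeasure_def`);
* `stub_areaDissipation` — the registered signature, verbatim.

No differentiation under the integral sign is needed: only the pointwise sign of `∂ₜ √D_t`.
Everything is PROVED (no `sorry`, no new definitions, no named facts). Test case: for the static
slice (`isCylinderMCF_staticSlice`, `H = 0`) the area is constant.

References: G. Huisken, *Flow by mean curvature of convex surfaces into spheres*, J. Differential
Geom. 20 (1984), §3; C. Mantegazza, *Lecture Notes on Mean Curvature Flow*, Birkhäuser 2011,
Prop. 2.3.3 and Cor. 2.3.4; H. Federer, *Geometric Measure Theory* (1969), 3.2.3 and 3.2.46.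
-/

-- the prescribed namespace `Summit.SmoothPoincare4.SmoothPoincare4.…` repeats `SmoothPoincare4`
set_option linter.dupNamespace false

noncomputable section

open Bundle MeasureTheory Set Function Filter Module
open scoped Manifold ContDiff ENNReal Topology RealInnerProductSpace NNReal Matrix

namespace Summit.SmoothPoincare4.SmoothPoincare4.Cruxes.CylinderRungTwo.KillingFlux

open Literature.Geometry.Riemannian Literature.Geometry.Riemannian.EuclideanHypersurface
open Literature.Geometry.Lorentzian Literature.Geometry.Lorentzian.PseudoRiemannianMetric
open Literature.Analysis.Calculus

/-! ## The coordinate-frame area density of an immersion of an `m`-manifold -/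

section ChartDensity

variable {m : ℕ} {N : Type*} [TopologicalSpace N] [ChartedSpace (EuclideanSpace ℝ (Fin m)) N]
  [IsManifold (𝓡 m) ∞ N]
  {W : Type*} [NormedAddCommGroup W] [InnerProductSpace ℝ W]

/-- The Gram matrix of the coordinate frame at `w` (local frame of the trivialisation at `w`) for
the induced form of `f : N → W` is the Gram matrix of the basis `basisAt` of `T_w N` (tree
`gram_localFrame_eq_gram_basisAt`, any codimension). [folklore] -/
theorem gram_localFrame_eq_gram_basisAt_of_immersion (f : N → W) (w : N) :
    (Matrix.of fun i j => (euclideanMetric W).inducedBilin (𝓡 m) f w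
      ((trivializationAt (EuclideanSpace ℝ (Fin m)) (TangentSpace (𝓡 m)) w).localFrame
        (EuclideanSpace.basisFun (Fin m) ℝ).toBasis i w)
      ((trivializationAt (EuclideanSpace ℝ (Fin m)) (TangentSpace (𝓡 m)) w).localFrame
        (EuclideanSpace.basisFun (Fin m) ℝ).toBasis j w)) =
    Matrix.of fun i j => (euclideanMetric W).inducedBilin (𝓡 m) f w
      ((trivializationAt (EuclideanSpace ℝ (Fin m)) (TangentSpace (𝓡 m)) w).basisAt
        (EuclideanSpace.basisFun (Fin m) ℝ).toBasis
          (FiberBundle.mem_baseSet_trivializationAt' w) i)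
      ((trivializationAt (EuclideanSpace ℝ (Fin m)) (TangentSpace (𝓡 m)) w).basisAt
        (EuclideanSpace.basisFun (Fin m) ℝ).toBasis
          (FiberBundle.mem_baseSet_trivializationAt' w) j) := by
  ext i j
  rw [Matrix.of_apply, Matrix.of_apply,
    Trivialization.localFrame_apply_of_mem_baseSet _ _ (FiberBundle.mem_baseSet_trivializationAt' w),
    Trivialization.localFrame_apply_of_mem_baseSet _ _ (FiberBundle.mem_baseSet_trivializationAt' w)]

/-- **The chart density of the induced metric `f^*δ` at the centre of its own chart is the
coordinate-frame Gram determinant** (tree `chartGramMatrix_inducedRiemannianMetric_self`, any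
codimension). [folklore] -/
theorem chartGramMatrix_inducedRiemannianMetric_self_of_immersion {f : N → W}
    (hf : (euclideanMetric W).IsSpacelikeImmersion (𝓡 m) f) (w : N) :
    chartGramMatrix ((euclideanMetric W).inducedRiemannianMetric f contMDiff_pullbackBilin_holds hf)
        w (extChartAt (𝓡 m) w w) =
      Matrix.of fun i j => (euclideanMetric W).inducedBilin (𝓡 m) f w
        ((trivializationAt (EuclideanSpace ℝ (Fin m)) (TangentSpace (𝓡 m)) w).localFrame
          (EuclideanSpace.basisFun (Fin m) ℝ).toBasis i w)
        ((trivializationAt (EuclideanSpace ℝ (Fin m)) (TangentSpace (𝓡 m)) w).localFrame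
          (EuclideanSpace.basisFun (Fin m) ℝ).toBasis j w) := by
  rw [chartGramMatrix_eq_gram_localFrame _ w (mem_extChartAt_target w), extChartAt_to_inv (I := 𝓡 m) w]
  rfl

end ChartDensity

/-! ## Smooth cylinder flows: the area element decays by `H²`, the area is non-increasing -/

section CylinderFlow

variable {M : Type} [TopologicalSpace M] [ChartedSpace (EuclideanSpace ℝ (Fin 4)) M]
  [IsManifold (𝓡 4) ∞ M] {F ν : ℝ → M → EuclideanSpace ℝ (Fin 6)} {T : ℝ}

/-- The flow equation of a cylinder flow in `deriv` form: `∂ₜF(t, x) = -H(t, x) ν(t, x)` for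
`t ≥ T`. [folklore] -/
theorem IsCylinderMCF.deriv_slice_eq (h : IsCylinderMCF M F ν T) {t : ℝ} (ht : T ≤ t) (x : M) :
    deriv (fun s => F s x) t =
      -((euclideanMetric (EuclideanSpace ℝ (Fin 6))).meanCurvature (F t)
          contMDiff_pullbackBilin_holds (h.isSpacelikeImmersion t ht) (ν t) x) • ν t x := by
  rw [← mfderiv_slice_apply_one]
  exact h.velocity_eq t ht x

/-- **Evolution of the induced metric along a cylinder flow**: for `t₀ ≥ T`, `p ∈ M`,
`u, w ∈ T_p M`, `d/dt|_{t₀} (F_t^*δ)_p(u, w) = -H(t₀, p) (K(u, w) + K(w, u))`, `K` the second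
fundamental form of `(F t₀, ν t₀)` in `ℝ⁶` (Huisken's `∂ₜ g_{ij} = -2 H h_{ij}`, here in codimension
two for the chosen unit normal `ν ⊥ n_N`). [cite: Huisken1984, Lemma 3.2] -/
theorem IsCylinderMCF.hasDerivAt_inducedBilin (h : IsCylinderMCF M F ν T) {t₀ : ℝ} (ht₀ : T ≤ t₀)
    (p : M) (u w : TangentSpace (𝓡 4) p) :
    HasDerivAt (fun t => (euclideanMetric (EuclideanSpace ℝ (Fin 6))).inducedBilin (𝓡 4) (F t) p u w)
      (-(euclideanMetric (EuclideanSpace ℝ (Fin 6))).meanCurvature (F t₀)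
          contMDiff_pullbackBilin_holds (h.isSpacelikeImmersion t₀ ht₀) (ν t₀) p *
        ((euclideanMetric (EuclideanSpace ℝ (Fin 6))).secondFundamentalForm (𝓡 4) (F t₀) (ν t₀)
            p u w +
          (euclideanMetric (EuclideanSpace ℝ (Fin 6))).secondFundamentalForm (𝓡 4) (F t₀) (ν t₀)
            p w u)) t₀ := by
  obtain ⟨U, hU, hIU, hF⟩ := h.contMDiffOn
  exact hasDerivAt_inducedBilin_of_normalVelocity hU hF (hIU (mem_Ici.2 ht₀))
    (h.contMDiff_normal t₀ ht₀) (h.isUnitNormal t₀ ht₀).isNormalTo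
    (fun y => h.deriv_slice_eq ht₀ y) p u w

/-- **The area element of a cylinder flow decays by `H²`**: for `t₀ ≥ T`, `p ∈ M` and a basis `β`
of `T_p M`, the Gram determinant `D(t) = det ((F_t^*δ)_p(βᵢ, βⱼ))` satisfies
`d/dt|_{t₀} √D = -H(t₀, p)² √D(t₀)` — Huisken's `∂ₜ μ_t = -H² μ_t` (1984, §3; Mantegazza 2011,
Prop. 2.3.3) for the flow in `N`; note that `H`, computed in `ℝ⁶` for `ν ⊥ n_N`, IS the mean
curvature of `Σ_t ⊂ N`. This pointwise identity is the input both of the area dissipation below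
and of Hamilton's monotonicity formula in `N`. [cite: Huisken1984, Lemma 3.2] [cite: Mantegazza2011, Prop. 2.3.3] -/
theorem IsCylinderMCF.hasDerivAt_sqrt_det_gram (h : IsCylinderMCF M F ν T) {t₀ : ℝ}
    (ht₀ : T ≤ t₀) (p : M) {ι : Type*} [Fintype ι] [DecidableEq ι]
    (β : Module.Basis ι ℝ (TangentSpace (𝓡 4) p)) :
    HasDerivAt (fun t => Real.sqrt (Matrix.of fun i j =>
        (euclideanMetric (EuclideanSpace ℝ (Fin 6))).inducedBilin (𝓡 4) (F t) p (β i) (β j)).det)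
      (-((euclideanMetric (EuclideanSpace ℝ (Fin 6))).meanCurvature (F t₀)
          contMDiff_pullbackBilin_holds (h.isSpacelikeImmersion t₀ ht₀) (ν t₀) p) ^ 2 *
        Real.sqrt (Matrix.of fun i j =>
          (euclideanMetric (EuclideanSpace ℝ (Fin 6))).inducedBilin (𝓡 4) (F t₀) p (β i) (β j)).det)
      t₀ := by
  obtain ⟨U, hU, hIU, hF⟩ := h.contMDiffOn
  refine (hasDerivAt_sqrt_det_gram_of_normalVelocity hU hF (hIU (mem_Ici.2 ht₀))
    (h.contMDiff_normal t₀ ht₀) (h.isUnitNormal t₀ ht₀).isNormalTo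
    (fun y => h.deriv_slice_eq ht₀ y) (h.isSpacelikeImmersion t₀ ht₀) p β).congr_deriv ?_
  ring

/-- **Pointwise evolution of the coordinate-frame area density of a cylinder flow**: for `t₀ ≥ T`
and `w ∈ M`, `D_t(w) = det ((F_t^*δ)(∂ᵢ, ∂ⱼ))(w)` (coordinate frame of the trivialisation at `w`)
satisfies `d/dt|_{t₀} √D_t(w) = -H(t₀, w)² √D_{t₀}(w)`. [cite: Huisken1984, Lemma 3.2] [cite: Mantegazza2011, Prop. 2.3.3] -/
theorem IsCylinderMCF.hasDerivAt_sqrt_det_gram_localFrame (h : IsCylinderMCF M F ν T) {t₀ : ℝ}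
    (ht₀ : T ≤ t₀) (w : M) :
    HasDerivAt (fun t => Real.sqrt (Matrix.of fun i j =>
        (euclideanMetric (EuclideanSpace ℝ (Fin 6))).inducedBilin (𝓡 4) (F t) w
          ((trivializationAt (EuclideanSpace ℝ (Fin 4)) (TangentSpace (𝓡 4)) w).localFrame
            (EuclideanSpace.basisFun (Fin 4) ℝ).toBasis i w)
          ((trivializationAt (EuclideanSpace ℝ (Fin 4)) (TangentSpace (𝓡 4)) w).localFrame
            (EuclideanSpace.basisFun (Fin 4) ℝ).toBasis j w)).det)
      (-((euclideanMetric (EuclideanSpace ℝ (Fin 6))).meanCurvature (F t₀)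
          contMDiff_pullbackBilin_holds (h.isSpacelikeImmersion t₀ ht₀) (ν t₀) w) ^ 2 *
        Real.sqrt (Matrix.of fun i j =>
          (euclideanMetric (EuclideanSpace ℝ (Fin 6))).inducedBilin (𝓡 4) (F t₀) w
            ((trivializationAt (EuclideanSpace ℝ (Fin 4)) (TangentSpace (𝓡 4)) w).localFrame
              (EuclideanSpace.basisFun (Fin 4) ℝ).toBasis i w)
            ((trivializationAt (EuclideanSpace ℝ (Fin 4)) (TangentSpace (𝓡 4)) w).localFrame
              (EuclideanSpace.basisFun (Fin 4) ℝ).toBasis j w)).det) t₀ := by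
  simp_rw [gram_localFrame_eq_gram_basisAt_of_immersion]
  exact h.hasDerivAt_sqrt_det_gram ht₀ w _

/-- **The area density of a cylinder flow is non-increasing in time**: for every `w ∈ M`,
`t ↦ √D_t(w)` is antitone on `[T, ∞)` (its derivative `-H² √D_t(w)` is `≤ 0`).
[cite: Huisken1984, §3] [cite: Mantegazza2011, Prop. 2.3.3] -/
theorem IsCylinderMCF.antitoneOn_sqrt_det_gram_localFrame (h : IsCylinderMCF M F ν T) (w : M) :
    AntitoneOn (fun t => Real.sqrt (Matrix.of fun i j =>
        (euclideanMetric (EuclideanSpace ℝ (Fin 6))).inducedBilin (𝓡 4) (F t) w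
          ((trivializationAt (EuclideanSpace ℝ (Fin 4)) (TangentSpace (𝓡 4)) w).localFrame
            (EuclideanSpace.basisFun (Fin 4) ℝ).toBasis i w)
          ((trivializationAt (EuclideanSpace ℝ (Fin 4)) (TangentSpace (𝓡 4)) w).localFrame
            (EuclideanSpace.basisFun (Fin 4) ℝ).toBasis j w)).det) (Ici T) := by
  set f : ℝ → ℝ := fun t => Real.sqrt (Matrix.of fun i j =>
        (euclideanMetric (EuclideanSpace ℝ (Fin 6))).inducedBilin (𝓡 4) (F t) w
          ((trivializationAt (EuclideanSpace ℝ (Fin 4)) (TangentSpace (𝓡 4)) w).localFrame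
            (EuclideanSpace.basisFun (Fin 4) ℝ).toBasis i w)
          ((trivializationAt (EuclideanSpace ℝ (Fin 4)) (TangentSpace (𝓡 4)) w).localFrame
            (EuclideanSpace.basisFun (Fin 4) ℝ).toBasis j w)).det with hf
  have hd : ∀ t, T ≤ t → HasDerivAt f (deriv f t) t := fun t ht =>
    (h.hasDerivAt_sqrt_det_gram_localFrame ht w).differentiableAt.hasDerivAt
  refine antitoneOn_of_hasDerivWithinAt_nonpos (convex_Ici T)
    (fun t ht => (hd t ht).continuousAt.continuousWithinAt)
    (fun t ht => (hd t (interior_subset ht)).hasDerivWithinAt) fun t ht => ?_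
  rw [(h.hasDerivAt_sqrt_det_gram_localFrame (interior_subset ht) w).deriv]
  exact mul_nonpos_of_nonpos_of_nonneg (neg_nonpos.2 (sq_nonneg _)) (Real.sqrt_nonneg _)

/-- The cross-sections of a cylinder flow are embedded: `F t` is injective for `t ≥ T`. [folklore] -/
theorem IsCylinderMCF.injective (h : IsCylinderMCF M F ν T) {t : ℝ} (ht : T ≤ t) :
    Injective (F t) :=
  (h.isSmoothEmbedding t ht).isEmbedding.injective

variable [T2Space M] [CompactSpace M]

/-- **Area formula for the cross-sections**: `μHE⁴(F_t(M)) = μ_{F_t^*δ}(M)`, the induced Riemannian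
measure of the embedded cross-section (tree `riemannianMeasure_induced_apply`, Federer 3.2.3/3.2.46).
[folklore] -/
theorem IsCylinderMCF.euclideanHausdorffMeasure_range_eq [MeasurableSpace M] [BorelSpace M]
    (h : IsCylinderMCF M F ν T) {t : ℝ} (ht : T ≤ t) :
    μHE[4] (range (F t)) = riemannianMeasure ((euclideanMetric (EuclideanSpace ℝ (Fin 6))).inducedRiemannianMetric
      (F t) contMDiff_pullbackBilin_holds (h.isSpacelikeImmersion t ht)) univ := by
  rw [riemannianMeasure_induced_apply (h.isSpacelikeImmersion t ht) (h.injective ht)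
    MeasurableSet.univ, image_univ]

/-- **`μ_t(M) = ∫ θ dμ_s`** with the density ratio `θ = √D_t/√D_s` of the coordinate-frame Gram
determinants (tree `riemannianMeasure_eq_withDensity_sqrt_det_div`, read at the centres of the
charts). [folklore] -/
theorem IsCylinderMCF.riemannianMeasure_univ_eq_lintegral [MeasurableSpace M] [BorelSpace M]
    (h : IsCylinderMCF M F ν T) {s t : ℝ} (hs : T ≤ s) (ht : T ≤ t) :
    riemannianMeasure ((euclideanMetric (EuclideanSpace ℝ (Fin 6))).inducedRiemannianMetric
        (F t) contMDiff_pullbackBilin_holds (h.isSpacelikeImmersion t ht)) univ =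
      ∫⁻ w, ENNReal.ofReal
        (Real.sqrt (Matrix.of fun i j =>
          (euclideanMetric (EuclideanSpace ℝ (Fin 6))).inducedBilin (𝓡 4) (F t) w
            ((trivializationAt (EuclideanSpace ℝ (Fin 4)) (TangentSpace (𝓡 4)) w).localFrame
              (EuclideanSpace.basisFun (Fin 4) ℝ).toBasis i w)
            ((trivializationAt (EuclideanSpace ℝ (Fin 4)) (TangentSpace (𝓡 4)) w).localFrame
              (EuclideanSpace.basisFun (Fin 4) ℝ).toBasis j w)).det /
         Real.sqrt (Matrix.of fun i j =>
          (euclideanMetric (EuclideanSpace ℝ (Fin 6))).inducedBilin (𝓡 4) (F s) w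
            ((trivializationAt (EuclideanSpace ℝ (Fin 4)) (TangentSpace (𝓡 4)) w).localFrame
              (EuclideanSpace.basisFun (Fin 4) ℝ).toBasis i w)
            ((trivializationAt (EuclideanSpace ℝ (Fin 4)) (TangentSpace (𝓡 4)) w).localFrame
              (EuclideanSpace.basisFun (Fin 4) ℝ).toBasis j w)).det)
        ∂riemannianMeasure ((euclideanMetric (EuclideanSpace ℝ (Fin 6))).inducedRiemannianMetric
          (F s) contMDiff_pullbackBilin_holds (h.isSpacelikeImmersion s hs)) := by
  rw [riemannianMeasure_eq_withDensity_sqrt_det_div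
      ((euclideanMetric (EuclideanSpace ℝ (Fin 6))).inducedRiemannianMetric (F t)
        contMDiff_pullbackBilin_holds (h.isSpacelikeImmersion t ht))
      ((euclideanMetric (EuclideanSpace ℝ (Fin 6))).inducedRiemannianMetric (F s)
        contMDiff_pullbackBilin_holds (h.isSpacelikeImmersion s hs)),
    withDensity_apply _ MeasurableSet.univ, Measure.restrict_univ]
  refine lintegral_congr fun w => ?_
  rw [chartGramMatrix_inducedRiemannianMetric_self_of_immersion,
    chartGramMatrix_inducedRiemannianMetric_self_of_immersion]

/-- **Area dissipation for the normalised Hausdorff measure**: `t ↦ μHE⁴(F_t(M))` is non-increasing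
on `[T, ∞)` (`μ_t(M) = ∫ √D_t/√D_s dμ_s` with `√D_t ≤ √D_s` pointwise for `T ≤ s ≤ t`).
[cite: Huisken1984, §3] [cite: Mantegazza2011, Prop. 2.3.3] -/
theorem IsCylinderMCF.antitoneOn_euclideanHausdorffMeasure_range (h : IsCylinderMCF M F ν T) :
    AntitoneOn (fun t => μHE[4] (range (F t))) (Ici T) := by
  letI : MeasurableSpace M := borel M
  haveI : BorelSpace M := ⟨rfl⟩
  intro s hs t ht hst
  show μHE[4] (range (F t)) ≤ μHE[4] (range (F s))
  rw [h.euclideanHausdorffMeasure_range_eq hs, h.euclideanHausdorffMeasure_range_eq ht,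
    h.riemannianMeasure_univ_eq_lintegral hs ht, h.riemannianMeasure_univ_eq_lintegral hs hs]
  refine lintegral_mono fun w => ENNReal.ofReal_le_ofReal ?_
  exact div_le_div_of_nonneg_right (h.antitoneOn_sqrt_det_gram_localFrame w hs ht hst)
    (Real.sqrt_nonneg _)

/-- **Area dissipation along a smooth cylinder flow**: the `4`-dimensional Hausdorff measure of the
cross-section `F_t(M)` is non-increasing on `[T, ∞)` (classically `d/dt Area(M_t) = -∫ H² dμ_t ≤ 0`;
`μHE⁴` is a constant non-zero multiple of `μH⁴`). [cite: Huisken1984, §3] [cite: Mantegazza2011, Prop. 2.3.3] -/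
theorem IsCylinderMCF.antitoneOn_hausdorffMeasure_range (h : IsCylinderMCF M F ν T) :
    AntitoneOn (fun t => μH[4] (range (F t))) (Ici T) := by
  intro s hs t ht hst
  have key := h.antitoneOn_euclideanHausdorffMeasure_range hs ht hst
  simp only [Measure.euclideanHausdorffMeasure_def, Measure.smul_apply, ENNReal.smul_def,
    smul_eq_mul] at key
  exact (ENNReal.mul_le_mul_iff_right
    (ENNReal.coe_ne_zero.2 (Measure.addHaarScalarFactor_volume_hausdorffMeasure_ne_zero 4))
    ENNReal.coe_ne_top).1 key

end CylinderFlow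

/-- **Registered stub `stub_areaDissipation` (line `killing-flux`, input (a) of the immortal half
"large-scale relaxation"): AREA DISSIPATION.** Along a smooth mean curvature flow
`IsCylinderMCF M F ν T` of closed embedded cross-sections of `N = S⁴ × ℝ ⊂ ℝ⁶`, the area
`μH⁴(F_t(M))` is non-increasing on `[T, ∞)`: `∂ₜ √det g_t = -H² √det g_t` pointwise
(`IsCylinderMCF.hasDerivAt_sqrt_det_gram_localFrame`), hence `μ_t(M) = ∫ (√D_t/√D_s) dμ_s` is
non-increasing, and `μH⁴(F_t(M))` is a constant multiple of `μ_t(M)` by the area formula for embedded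
submanifolds. Huisken 1984, §3; Mantegazza 2011, Prop. 2.3.3 / Cor. 2.3.4.
[cite: Huisken1984, §3] [cite: Mantegazza2011, Prop. 2.3.3] -/
theorem stub_areaDissipation :
    ∀ (M : Type) [TopologicalSpace M] [T2Space M] [SecondCountableTopology M]
      [ChartedSpace (EuclideanSpace ℝ (Fin 4)) M] [IsManifold (𝓡 4) ∞ M] [CompactSpace M]
      (F : ℝ → M → EuclideanSpace ℝ (Fin 6)) (ν : ℝ → M → EuclideanSpace ℝ (Fin 6)) (T : ℝ),
      IsCylinderMCF M F ν T → AntitoneOn (fun t => μH[4] (Set.range (F t))) (Set.Ici T) :=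
  fun _ _ _ _ _ _ _ _ _ _ h => h.antitoneOn_hausdorffMeasure_range

end Summit.SmoothPoincare4.SmoothPoincare4.Cruxes.CylinderRungTwo.KillingFlux

end
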